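import Summits.AnomalousDissipation.AnomalousDissipation.Theorems.SawtoothPulseCascadeK1LocalisedCascadeWindowBlockH
import Summits.AnomalousDissipation.AnomalousDissipation.Theorems.SawtoothPulseCascadeK1LocalisedCascadeClassStepV
import Summits.AnomalousDissipation.AnomalousDissipation.Theorems.SawtoothPulseCascadeK1LocalisedCascadeFibreMarginals

/-!
# K1loc, line `Spectral` / thin start — helper: A GENERAL SPECTRAL CLASS THROUGH AN H HALF-STEP OF THE INVISCID CASCADE

Helper file of the prover lane on the crux `K1LocalisedCascade` (stmt-AnomalousDissipation-19491), route
`SawtoothPulseCascade` (S-D fibre ledger; memo v11 §13).  The twin of `…ClassStepV` for `b_j = a_j ∘ Φ_H`: fibres `k₀`,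
window variable `k₁`, per-fibre plateau `p(k₀)`, input cut-off trapezoid `(Q₁,Q₂)` in `k₁`; the far tail in `k₀` is that of `a_j`
(horizontal marginals are H-invariant, `…FibreMarginals.tsum_horizontalWeight_hstep`):
* `sum_window_iterate_hstep_le` — `Σ_{k∈W}‖𝓕b_j(k)‖² ≤ (J + √(Σ'[Λ ≤ |k₀| ≤ Λ' ∧ Q₁ < |k₁|]‖𝓕a_j‖²))²`;
* `tsum_class_hstep_le` — `Σ'[q]‖𝓕b_j‖² ≤ (J + √PT)² + ((1+γ)^{2j}/Λ')²` for `{q} ∩ {|k₀| ≤ Λ'} ⊆ W`.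
These serve the shallow-`b` classes `B`, `Bc(m)` of the ledger ((B-H), (Bc-H) of memo v11 §13).  No definitions; no statement
about the crux. [cite: Grafakos2014, Prop. 3.1.2 (5), Prop. 3.2.7 (3), §3.1.3] [cite: ElgindiLissMattingly2025, §1 (slope ±1 branches)]
[problem: turb]
-/

-- `Summit.<Summit>.<Problem>`: single-conjunct summit, the duplicate namespace segment is deliberate.
set_option linter.dupNamespace false

noncomputable section

namespace Summit.AnomalousDissipation.AnomalousDissipation.Theorems.SawtoothPulseCascade.K1Window

open MeasureTheory Set Filter Topology UnitAddTorus Function Complex Metric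
open scoped Real ENNReal
open Literature.Analysis Literature.Analysis.FunctionSpaces Literature.Analysis.FunctionSpaces.Torus Literature.Analysis.FluidPDE
open Literature.Analysis.FluidPDE.ShearStage
open Literature.Analysis.FluidPDE.SawtoothCascade Literature.Analysis.FluidPDE.SawtoothCascade.CascadeParams
open Summit.AnomalousDissipation.AnomalousDissipation.Theorems.SawtoothPulseCascade.K1Start
open Summit.AnomalousDissipation.AnomalousDissipation.Theorems.SawtoothPulseCascade.K1Flat
open Summit.AnomalousDissipation.AnomalousDissipation.Theorems.SawtoothPulseCascade.K1Ledger.From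

/-! ## A window and a class of the H half-step of the iterates -/

section Cascade

variable (P : CascadeParams)

/-- **Window of `b_j` through the H half-step** (`…WindowBlockH` for the iterates; see the file header).
[cite: Grafakos2014, Prop. 3.1.2 (5), Prop. 3.2.7 (3), §3.1.3] -/
theorem sum_window_iterate_hstep_le {G : ℕ} (hγ : P.γ = G) (hδ₀ : 0 < P.δ₀) (hd : 0 < P.d) (hN₀ : 1 ≤ P.N₀)
    (hρN : 1 ≤ P.ρN) (a b : ℕ → UnitAddTorus (Fin 2) → ℝ) (has : ∀ j, IsSmooth (a j)) (h0 : a 0 = datum)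
    (hb : ∀ j, b j = a j ∘ shearMap 0 1 (amp ⟨P.U j, P.U_periodic j, P.contDiff_U (P.δ_pos hδ₀ hd j)⟩ P.γ))
    (hab : ∀ j, a (j + 1) = b j ∘ shearMap 1 0 (amp ⟨P.U j, P.U_periodic j, P.contDiff_U (P.δ_pos hδ₀ hd j)⟩ P.γ))
    (j : ℕ) {Q₁ Q₂ Λ Λ' : ℕ} (hQ : Q₁ < Q₂) (p : ℤ → ℕ)
    (W : Finset (Fin 2 → ℤ)) (hW : ∀ k ∈ W, (Λ : ℤ) ≤ |k 0| ∧ |k 0| ≤ Λ')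
    (hWp : ∀ k ∈ W, |k 1| + Q₂ ≤ (p (k 0) : ℤ)) (hpG : ∀ k ∈ W, p (k 0) < (k 0).natAbs * G)
    {d₀ M ε₀ A τ : ℝ} (hd₀ : 0 < d₀) (hM : 1 ≤ M) (hMδ : M * P.δ j < π / 2) (hMd : M * P.δ j < π * P.N j * d₀)
    (hA0 : 0 ≤ A) (hA : ∀ k ∈ W, ((p (k 0) : ℝ) + ((k 0).natAbs * G : ℕ)) / ((((k 0).natAbs * G : ℕ) : ℝ) - p (k 0)) ≤ A)
    (hτ : ∀ k ∈ W, π / ((((k 0).natAbs * G : ℕ) : ℝ) - p (k 0)) ≤ τ)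
    (hAd : 8 * τ ≤ A * d₀) (hε0 : 0 ≤ ε₀)
    (hε : A * (2 * π * ((Λ' * G : ℕ) : ℝ) * (Real.exp (-(M ^ 2 / 2)) / (2 * P.N j))) ≤ ε₀) :
    ∑ k ∈ W, ‖mFourierCoeff (fun x => (b j x : ℂ)) k‖ ^ 2 ≤
      ((((Q₁ : ℝ) + Q₂) / ((Q₂ : ℝ) - Q₁)) * (ε₀ + A * Real.sqrt ((2 * P.N j : ℕ) * (4 * d₀))) +
        Real.sqrt (∑' k : Fin 2 → ℤ, (if (Λ : ℤ) ≤ |k 0| ∧ |k 0| ≤ Λ' ∧ (Q₁ : ℤ) < |k 1| then (1 : ℝ) else 0) *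
          ‖mFourierCoeff (fun x => (a j x : ℂ)) k‖ ^ 2)) ^ 2 := by
  set Ψ : ShearProfile := amp ⟨P.U j, P.U_periodic j, P.contDiff_U (P.δ_pos hδ₀ hd j)⟩ P.γ with hΨ
  set aC : UnitAddTorus (Fin 2) → ℂ := fun x => (a j x : ℂ) with haC
  have has' : IsSmooth (a j) := has j
  have hac : Continuous aC := Complex.continuous_ofReal.comp has'.continuous
  have hasum : Summable fun k => ‖mFourierCoeff aC k‖ := summable_norm_mFourierCoeff_ofReal_of_isSmooth has'
  have ha1 : ∀ x, ‖aC x‖ ≤ 1 := fun x => by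
    simp only [haC, Complex.norm_real, Real.norm_eq_abs]
    exact (abs_iterate_le_one P hδ₀ hd a b h0 hb hab j).1 x
  have hbC' : (fun x => (b j x : ℂ)) = aC ∘ shearMap 0 1 Ψ := by
    show (fun x => (b j x : ℂ)) = (fun x => (a j x : ℂ)) ∘ shearMap 0 1 Ψ
    rw [hb j]; rfl
  rw [hbC']
  exact sum_windowBlock_hstep_le P hγ hδ₀ hd hN₀ hρN j hac hasum ha1 hQ p W hW hWp hpG hd₀ hM hMδ hMd hA0 hA hτ hAd hε0 hε

/-- **A class of `b_j` through the H half-step**: for a predicate `q` with `{q} ∩ {|k₀| ≤ Λ'} ⊆ W`,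
`Σ'[q]‖𝓕b_j‖² ≤ (J + √PT)² + ((1+γ)^{2j}/Λ')²` (see the file header). [cite: Grafakos2014, Prop. 3.1.2 (5), Prop. 3.2.7 (3), §3.1.3] -/
theorem tsum_class_hstep_le {G : ℕ} (hγ : P.γ = G) (hδ₀ : 0 < P.δ₀) (hd : 0 < P.d) (hN₀ : 1 ≤ P.N₀)
    (hρN : 1 ≤ P.ρN) (a b : ℕ → UnitAddTorus (Fin 2) → ℝ) (has : ∀ j, IsSmooth (a j)) (h0 : a 0 = datum)
    (hb : ∀ j, b j = a j ∘ shearMap 0 1 (amp ⟨P.U j, P.U_periodic j, P.contDiff_U (P.δ_pos hδ₀ hd j)⟩ P.γ))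
    (hab : ∀ j, a (j + 1) = b j ∘ shearMap 1 0 (amp ⟨P.U j, P.U_periodic j, P.contDiff_U (P.δ_pos hδ₀ hd j)⟩ P.γ))
    (j : ℕ) {Q₁ Q₂ Λ Λ' : ℕ} (hQ : Q₁ < Q₂) (hΛ' : 0 < Λ') (p : ℤ → ℕ)
    (q : (Fin 2 → ℤ) → Prop) [DecidablePred q]
    (W : Finset (Fin 2 → ℤ)) (hqW : ∀ k, q k → |k 0| ≤ (Λ' : ℤ) → k ∈ W)
    (hW : ∀ k ∈ W, (Λ : ℤ) ≤ |k 0| ∧ |k 0| ≤ Λ')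
    (hWp : ∀ k ∈ W, |k 1| + Q₂ ≤ (p (k 0) : ℤ)) (hpG : ∀ k ∈ W, p (k 0) < (k 0).natAbs * G)
    {d₀ M ε₀ A τ : ℝ} (hd₀ : 0 < d₀) (hM : 1 ≤ M) (hMδ : M * P.δ j < π / 2) (hMd : M * P.δ j < π * P.N j * d₀)
    (hA0 : 0 ≤ A) (hA : ∀ k ∈ W, ((p (k 0) : ℝ) + ((k 0).natAbs * G : ℕ)) / ((((k 0).natAbs * G : ℕ) : ℝ) - p (k 0)) ≤ A)
    (hτ : ∀ k ∈ W, π / ((((k 0).natAbs * G : ℕ) : ℝ) - p (k 0)) ≤ τ)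
    (hAd : 8 * τ ≤ A * d₀) (hε0 : 0 ≤ ε₀)
    (hε : A * (2 * π * ((Λ' * G : ℕ) : ℝ) * (Real.exp (-(M ^ 2 / 2)) / (2 * P.N j))) ≤ ε₀) :
    ∑' k : Fin 2 → ℤ, (if q k then (1 : ℝ) else 0) * ‖mFourierCoeff (fun x => (b j x : ℂ)) k‖ ^ 2 ≤
      ((((Q₁ : ℝ) + Q₂) / ((Q₂ : ℝ) - Q₁)) * (ε₀ + A * Real.sqrt ((2 * P.N j : ℕ) * (4 * d₀))) +
        Real.sqrt (∑' k : Fin 2 → ℤ, (if (Λ : ℤ) ≤ |k 0| ∧ |k 0| ≤ Λ' ∧ (Q₁ : ℤ) < |k 1| then (1 : ℝ) else 0) *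
          ‖mFourierCoeff (fun x => (a j x : ℂ)) k‖ ^ 2)) ^ 2 +
        ((1 + P.γ) ^ (2 * j) / Λ') ^ 2 := by
  have hγ0 : 0 ≤ P.γ := by rw [hγ]; exact Nat.cast_nonneg G
  set Ψ : ShearProfile := amp ⟨P.U j, P.U_periodic j, P.contDiff_U (P.δ_pos hδ₀ hd j)⟩ P.γ with hΨ
  have has' : IsSmooth (a j) := has j
  have hbc : Continuous fun x => (b j x : ℂ) := by
    rw [hb j]
    exact Complex.continuous_ofReal.comp (has'.continuous.comp (continuous_shearMap 0 1 _))
  have hcs : Summable fun k => ‖mFourierCoeff (fun x => (b j x : ℂ)) k‖ ^ 2 :=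
    (hasSum_sq_mFourierCoeff_of_continuous hbc).summable
  refine (tsum_indicator_le_sum_add_far hcs (fun k => sq_nonneg _) q 0 Λ' W hqW).trans (add_le_add ?_ ?_)
  · exact sum_window_iterate_hstep_le P hγ hδ₀ hd hN₀ hρN a b has h0 hb hab j hQ p W hW hWp hpG hd₀ hM hMδ hMd hA0 hA hτ
      hAd hε0 hε
  · have hinv := tsum_horizontalWeight_hstep (b := b j) has'.continuous Ψ (hb j)
      (w := fun m : ℤ => if (Λ' : ℝ) ≤ |((m : ℤ) : ℝ)| then (1 : ℝ) else 0) (C := 1)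
      (fun m => by split_ifs <;> norm_num)
    have h := tsum_far_iterate_le P hγ0 hδ₀ hd a b has h0 hb hab j 0 (R := (Λ' : ℝ)) (by exact_mod_cast hΛ')
    rw [hinv]
    exact h

end Cascade

end Summit.AnomalousDissipation.AnomalousDissipation.Theorems.SawtoothPulseCascade.K1Window
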